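/-
Copyright (c) 2026 the pub-hodgecm-mathlib formalisation cell (harness21).  Prover seat hodgecm-mathlib-LH4-p09 (g0): unit U3_Laws of the «(D-RAM) FOUR-FRAME» road,
TIER-2 file paying the §E row `stub_U3_edgeLaw_t2` of `Cruxes/H413/Lines/F0_P3c_DyRamFourFrame_U3_Laws.lean` (ED. 1 346a7211376d9651, :99) BY NAME; 2026-09-03.
-/
import Summits.HodgeConjecture.HodgeConjecture.Theorems.F0P3cDyRamFourFrameCensusDefs     -- ★ U2G DEFS LEAF (B-p08 (g41)): `fixedEdgeCount`; brings ★ #0a `UnitaryThreeFourFrameDefs` (`fixedVertexCount`, `frameElt`, …)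
import Summits.HodgeConjecture.HodgeConjecture.Theorems.F0P3cDyRamWildTransitivity          -- ★ p854580 (LH4-p02 (g12)): `wildTransitivity_holds`; brings ★ №1 LawDefs (`DyadicFence`, `WildTree`)
import Summits.HodgeConjecture.HodgeConjecture.Theorems.F0P3cDyRamWildTreeOfTransitivity     -- ★ p854579 (B-p04 (g61)): `wildTree_of_wildTransitivity`
import Literature.NumberTheory.Automorphic.UnitaryLatticeTreeEulerRelationRamified            -- ★ (LH5-p04): `nonempty_fixed_flags_equiv_fixed_edges_three_of_v`; brings ★ `RootedTree.ncard_fixedPoints_eq_ncard_fixedEdges_add_one`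
import Literature.NumberTheory.Automorphic.UnitaryLatticeTreeFixedFiniteModelTransport        -- ★ (F0P3a-p05): `finite_setOf_latticeGraphIso_eq_of_model`, `v_vandermonde_le_of_forall_v_le_one`; brings ★ J4a `finite_setOf_latticeGraphIso_diagonal_eq`, ★ `exists_unitary_diagonal_coe_eq_diagonal`
import Literature.NumberTheory.Automorphic.UnitaryThreeFourFrameLiteralUnitary                -- ★ (B-p04): `exists_unitary_coe_eq_smul_frameElt`, `frameElt_eq_conj_diagonal`, `formCongr_frameMatrix`, `isUnit_det_frameMatrix`
import Literature.NumberTheory.Automorphic.UnitaryLatticeTreeSeparableStableRoot              -- ★ `isSelfDualLattice_stdLattice_diagonal`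
import Literature.NumberTheory.Automorphic.UnitaryLatticeTreeStabilizer                       -- ★ `mapGL_stdLattice_eq_iff`
import HarnessLib

/-!
# Crux `H413`, line LH4 «(D-RAM) FOUR-FRAME» road — unit U3_Laws (iii), TIER 2: THE (K-1)(c) EDGE IDENTITY `e(Γ_b) + 1 = n₀(Γ_b) + n₂(Γ_b)`
# (pays `F0P3cDyRamFourFrameU3.stub_U3_edgeLaw_t2` BY NAME)

Cell `hodgecm-mathlib` (D-0151), FLOOR 0, crux item H413 = `stmt-HodgeConjecture-24833`, route of record `HCCMUnconditional`; squad F0∕P3c∕LH4 (req618∕req620), director s1812;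
heir LEAD F0P3a-plan (g19) «FOUR-FRAME SKELETON LANDED» EMIT #6 (dealer LH4-plan (g10) HELD-BY v1): tier-1 module `Cruxes/H413/Lines/F0_P3c_DyRamFourFrame_U3_Laws.lean`
ED. 1 (346a7211376d9651; assembler F0P3a-p01 (g30)), §E row `stub_U3_edgeLaw_t2` (:99).  THEOREMS ONLY (no `def`, no instance, no notation, no `sorry`, default heartbeats);
lane `--supports stmt-HodgeConjecture-24833 --as helper` (count-neutral).

WHAT IS PROVED.  `edgeLaw_t2` — the stub's text TOKEN FOR TOKEN: at every complete datum with finite residue field, behind the dyadic fence `|2| < 1` and the ramified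
quadratic datum `IsRamifiedQuadraticDatum σ ϖ d t`, for every four-frame family `f`, element datum `(α, β; n₁, n₂, n₃)` at threshold `depthOfRecord d` and frames `Γ b` with
matrix `frameElt σ f b α β`:  `fixedEdgeCount σ ϖ (Γ b) + 1 = fixedVertexCount σ ϖ 0 (Γ b) + fixedVertexCount σ ϖ 2 (Γ b)`.

THE MATHEMATICS ([Serre1980Trees, I §2.2, I §6.1]; [Kottwitz1988, §2]; [BruhatTits1972, §10]).  `Γ_b = Q_b·diag(α, β, 1)·Q_b⁻¹` is unitary for `Φ₃` (★
`exists_unitary_coe_eq_smul_frameElt`), so it acts on the lattice graph of `(K³, Φ₃)` by a graph automorphism (★ `latticeGraphIso`); behind the fence that graph is a TREE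
(★ `wildTree_of_wildTransitivity wildTransitivity_holds` — the line's (ii-0) Prop `WildTree`, which is FENCED: this is where `|2| < 1` is used).  (F) The fixed vertex set
of `Γ_b` is FINITE: every norm `N_i = ⟨f_i, f_i⟩` of the frame is `σ`-fixed, hence of EVEN valuation `2n_i` (datum clause (4)), so `A := Q_b·diag(ϖ^{n_i})` is a frame with
`ᵗσ(A)Φ₃A = diag(d)`, `|d_i| = 1`, and `Γ_b = A·diag(α, β, 1)·A⁻¹`; in the unimodular diagonal model the fixed vertices of the REGULAR diagonal `diag(α, β, 1)` (`α ≠ β`,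
`α, β ≠ 1`, all of norm one) form a finite set (★ J4a `finite_setOf_latticeGraphIso_diagonal_eq`), transported back by ★ `finite_setOf_latticeGraphIso_eq_of_model`.
(N) `M₀ := A·𝒪³` is a SELF-DUAL vertex (★ `isSelfDualLattice_stdLattice_diagonal` in the model + ★ `isVertex_formCongr_mapGL_inv_iff`) FIXED by `Γ_b` (`diag(α, β, 1)·𝒪³ = 𝒪³`).
(E) Hence the fixed set induces a finite non-empty subtree and `#fixed vertices = #fixed edges + 1` (★ `RootedTree.ncard_fixedPoints_eq_ncard_fixedEdges_add_one`).
(D) Dictionaries: a vertex of `(K³, Φ₃)` has type `0` or `2` and not both (★ `type_eq_zero_or_two_of_isVertexLattice_three`, ★ `not_isSelfDualLattice_of_isVertexLattice_two_of_v`),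
so `#fixed vertices = fixedVertexCount σ ϖ 0 Γ_b + fixedVertexCount σ ϖ 2 Γ_b`; the fixed edges are the fixed flags `N < M` (`M` self-dual, `N` of type two; ★
`nonempty_fixed_flags_equiv_fixed_edges_three_of_v`), i.e. `fixedEdgeCount σ ϖ Γ_b` (`N ≤ M ⟺ N < M` for lattices of different types).

* §1 `ncard_fixed_isVertexLattice_eq_fixedVertexCount`, `ncard_fixedEdges_eq_fixedEdgeCount` (the two dictionaries (D)).
* §2 `fixedEdgeCount_add_one_eq_of_finite_of_fixed` ((E) + (D): the identity for any unitary `γ` with a finite non-empty fixed vertex set on a tree).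
* §3 `exists_unimodularFrame_of_isFourFrameFamily` (the rescaled frame `A`), `finite_fixedVertices_frameElt` (F), `exists_fixedVertex_frameElt` (N).
* §4 the head `edgeLaw_t2`.

HONEST LABEL.  Count-neutral (`--supports`); nothing printed is asserted; the verdict of record for (D-RAM) stays PRINT [LanglandsShelstad1989 Thm. p. 484 ∕ Rogawski1990
Prop. 4.9.1 (a)] ∕ XL; `HC_CM` is proved only modulo the 7 printed citations (2 remaining named inputs: hLiu418 = `stmt-HodgeConjecture-24832`, h413 =
`stmt-HodgeConjecture-24833`) until rung 0 closes.

## References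
* [Serre1980Trees] J.-P. Serre, *Trees*, Springer (1980): Ch. I §2.2 (a finite tree with `n` vertices has `n − 1` edges), I §6.1 (fixed points of bounded groups), II §1.1.
* [Kottwitz1988] R. E. Kottwitz, *Tamagawa numbers*, Ann. of Math. 127 (1988), §2 Theorem 2 (the elliptic Euler–Poincaré relation).
* [Kottwitz1986BaseChangeUnits] R. E. Kottwitz, *Base change for unit elements of Hecke algebras*, Compositio Math. 60 (1986), §1 pp. 240–241 (orbital integrals of unit elements as fixed-lattice counts).
* [BruhatTits1972] F. Bruhat, J. Tits, *Groupes réductifs sur un corps local I*, Publ. Math. IHÉS 41 (1972), §10 (lattice models of the building of a unitary group).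
* [Rogawski1990] J. D. Rogawski, *Automorphic Representations of Unitary Groups in Three Variables*, Ann. of Math. Stud. 123 (1990), §3.6 pp. 28–29 (elliptic tori and frames), §4.9 pp. 54–55.
-/

set_option autoImplicit false

noncomputable section

namespace Summit.HodgeConjecture.HodgeConjecture.Cruxes.H413.F0P3cDyRamU3EdgeLawT2

open Matrix
open Literature.NumberTheory.Automorphic Literature.NumberTheory.Automorphic.HermitianLattice Literature.NumberTheory.Automorphic.UnitaryGroup
open Literature.NumberTheory.Automorphic.UnitaryLatticeTree Literature.NumberTheory.Automorphic.UnitaryThreeFourFrame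
open Literature.Combinatorics.SimpleGraph
open Summit.HodgeConjecture.HodgeConjecture.Cruxes.H413.F0P3cDyRamFourFrameLawDefs
open Summit.HodgeConjecture.HodgeConjecture.Cruxes.H413.F0P3cDyRamFourFrameCensusDefs (fixedEdgeCount)
open Summit.HodgeConjecture.HodgeConjecture.Cruxes.H413.F0P3cDyRamWildTransitivity (wildTransitivity_holds)
open Summit.HodgeConjecture.HodgeConjecture.Cruxes.H413.F0P3cDyRamWildTreeOfTransitivity (wildTree_of_wildTransitivity)
open scoped Valued WithZero Matrix MatrixGroups

/-! ## §1  The two dictionaries: fixed vertices of type `t` ↔ `fixedVertexCount`, fixed edges ↔ `fixedEdgeCount` -/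

section Dictionaries

variable {K : Type} [Field K] [Valued K ℤᵐ⁰] {σ : K →+* K} {ϖ : K}

/-- **FIXED VERTICES OF TYPE `t` ARE COUNTED BY `fixedVertexCount`**: the `γ`-fixed vertices `v` of the lattice graph of `(K³, Φ₃)` with `v.1` of type `t` are, through
`Subtype.val`, exactly the type-`t` vertex lattices `M` with `γ·M = M` (★ #0a H2). [cite: BruhatTits1972, §10] [cite: Rogawski1990, §4.9 Prop. 4.9.1 (a) p. 55] -/
theorem ncard_fixed_isVertexLattice_eq_fixedVertexCount (γ : ↥(unitaryGroupOfForm σ ((StdForm.antidiagonal 3).over K))) (t : ℕ) :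
    {v : {M : Submodule 𝒪[K] (Fin 3 → K) // IsVertex σ ϖ ((StdForm.antidiagonal 3).over K) M} |
        latticeGraphIso σ ϖ ((StdForm.antidiagonal 3).over K) γ v = v ∧ IsVertexLattice σ ϖ ((StdForm.antidiagonal 3).over K) t v.1}.ncard =
      fixedVertexCount σ ϖ t (γ : GL (Fin 3) K) := by
  classical
  unfold fixedVertexCount
  rw [← Set.ncard_image_of_injective _ Subtype.val_injective]
  congr 1
  ext M
  simp only [Set.mem_image, Set.mem_setOf_eq]
  constructor
  · rintro ⟨v, ⟨hv, ht⟩, rfl⟩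
    exact ⟨ht, congrArg Subtype.val hv⟩
  · rintro ⟨ht, hM⟩
    exact ⟨⟨M, ⟨t, ht⟩⟩, ⟨Subtype.ext hM, ht⟩, rfl⟩

/-- **FIXED EDGES ARE COUNTED BY `fixedEdgeCount`**: the `γ`-fixed edges of the lattice graph of `(K³, Φ₃)` are the `γ`-fixed flags `N < M` (`M` self-dual, `N` of type two;
★ `nonempty_fixed_flags_equiv_fixed_edges_three_of_v`), and these are the pairs counted by ★ U2G `fixedEdgeCount σ ϖ γ` (`N ≤ M ⟺ N < M`, as no lattice has both types —
★ `not_isSelfDualLattice_of_isVertexLattice_two_of_v`). [cite: Serre1980Trees, II §1.1] [cite: Kottwitz1986BaseChangeUnits, §1 pp. 240–241] -/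
theorem ncard_fixedEdges_eq_fixedEdgeCount (hvσ : ∀ a, Valued.v (σ a) = Valued.v a) (hϖ : Valued.v ϖ = WithZero.exp (-1 : ℤ))
    (γ : ↥(unitaryGroupOfForm σ ((StdForm.antidiagonal 3).over K))) :
    {e ∈ (latticeGraph σ ϖ ((StdForm.antidiagonal 3).over K)).edgeSet | ∀ v ∈ e, latticeGraphIso σ ϖ ((StdForm.antidiagonal 3).over K) γ v = v}.ncard =
      fixedEdgeCount σ ϖ (γ : GL (Fin 3) K) := by
  classical
  have hnot : ∀ M : Submodule 𝒪[K] (Fin 3 → K), IsVertexLattice σ ϖ ((StdForm.antidiagonal 3).over K) 2 M →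
      ¬ IsSelfDualLattice σ ϖ ((StdForm.antidiagonal 3).over K) M := fun M hM2 => not_isSelfDualLattice_of_isVertexLattice_two_of_v hvσ hϖ hM2
  obtain ⟨eP⟩ := nonempty_fixed_flags_equiv_fixed_edges_three_of_v hvσ hϖ γ
  unfold fixedEdgeCount
  rw [← Nat.card_coe_set_eq, ← Nat.card_congr eP, ← Nat.card_coe_set_eq]
  refine Nat.card_congr (Equiv.ofBijective (fun p => ⟨(p.1.1.1, p.1.2.1), p.2.1, p.2.2.1, p.2.2.2.1.le,
    congrArg Subtype.val p.2.2.2.2.1, congrArg Subtype.val p.2.2.2.2.2⟩) ⟨?_, ?_⟩)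
  · intro p q hpq
    have h := congrArg Subtype.val hpq
    simp only [Prod.mk.injEq] at h
    exact Subtype.ext (Prod.ext (Subtype.ext h.1) (Subtype.ext h.2))
  · rintro ⟨⟨M, N⟩, h0, h2, hle, hM, hN⟩
    have hlt : N < M := lt_of_le_of_ne hle fun h => hnot M (h ▸ h2) h0
    exact ⟨⟨(⟨M, ⟨0, h0⟩⟩, ⟨N, ⟨2, h2⟩⟩), h0, h2, hlt, Subtype.ext hM, Subtype.ext hN⟩, rfl⟩

end Dictionaries

/-! ## §2  The edge identity for any unitary `γ` with a finite non-empty fixed vertex set, on a tree -/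

section Identity

variable {K : Type} [Field K] [Valued K ℤᵐ⁰] {σ : K →+* K} {ϖ : K}

/-- **`e(γ) + 1 = n₀(γ) + n₂(γ)` FOR A FINITE NON-EMPTY FIXED SET ON A TREE.**  If the lattice graph of `(K³, Φ₃)` is a tree and `γ ∈ U(σ, Φ₃)` fixes a vertex and only
finitely many, then `fixedEdgeCount σ ϖ γ + 1 = fixedVertexCount σ ϖ 0 γ + fixedVertexCount σ ϖ 2 γ`: the fixed set induces a finite subtree (★
`RootedTree.ncard_fixedPoints_eq_ncard_fixedEdges_add_one`), its vertices split by type `0 ∕ 2` (★ `type_eq_zero_or_two_of_isVertexLattice_three`) and §1.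
[cite: Serre1980Trees, I §2.2; I §6.1] [cite: Kottwitz1988, §2 Theorem 2] -/
theorem fixedEdgeCount_add_one_eq_of_finite_of_fixed (hvσ : ∀ a, Valued.v (σ a) = Valued.v a) (hϖ : Valued.v ϖ = WithZero.exp (-1 : ℤ))
    (hT : (latticeGraph σ ϖ ((StdForm.antidiagonal 3).over K)).IsTree)
    (γ : ↥(unitaryGroupOfForm σ ((StdForm.antidiagonal 3).over K)))
    (hfin : {v | latticeGraphIso σ ϖ ((StdForm.antidiagonal 3).over K) γ v = v}.Finite)
    (hne : ∃ v, latticeGraphIso σ ϖ ((StdForm.antidiagonal 3).over K) γ v = v) :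
    fixedEdgeCount σ ϖ (γ : GL (Fin 3) K) + 1 =
      fixedVertexCount σ ϖ 0 (γ : GL (Fin 3) K) + fixedVertexCount σ ϖ 2 (γ : GL (Fin 3) K) := by
  classical
  obtain ⟨v₀, hv₀⟩ := hne
  have hE := RootedTree.ncard_fixedPoints_eq_ncard_fixedEdges_add_one hT (latticeGraphIso σ ϖ ((StdForm.antidiagonal 3).over K) γ) hfin hv₀
  have hnot : ∀ M : Submodule 𝒪[K] (Fin 3 → K), IsVertexLattice σ ϖ ((StdForm.antidiagonal 3).over K) 2 M →
      ¬ IsSelfDualLattice σ ϖ ((StdForm.antidiagonal 3).over K) M := fun M hM2 => not_isSelfDualLattice_of_isVertexLattice_two_of_v hvσ hϖ hM2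
  have hunion : {v : {M : Submodule 𝒪[K] (Fin 3 → K) // IsVertex σ ϖ ((StdForm.antidiagonal 3).over K) M} |
        latticeGraphIso σ ϖ ((StdForm.antidiagonal 3).over K) γ v = v} =
      {v | latticeGraphIso σ ϖ ((StdForm.antidiagonal 3).over K) γ v = v ∧ IsVertexLattice σ ϖ ((StdForm.antidiagonal 3).over K) 0 v.1} ∪
        {v | latticeGraphIso σ ϖ ((StdForm.antidiagonal 3).over K) γ v = v ∧ IsVertexLattice σ ϖ ((StdForm.antidiagonal 3).over K) 2 v.1} := by
    ext v
    simp only [Set.mem_setOf_eq, Set.mem_union]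
    constructor
    · intro h
      obtain ⟨d, hvd⟩ := v.2
      rcases type_eq_zero_or_two_of_isVertexLattice_three hvσ hϖ v_det_antidiagonal_three hvd with rfl | rfl
      · exact Or.inl ⟨h, hvd⟩
      · exact Or.inr ⟨h, hvd⟩
    · rintro (⟨h, -⟩ | ⟨h, -⟩) <;> exact h
  have hfinA : {v : {M : Submodule 𝒪[K] (Fin 3 → K) // IsVertex σ ϖ ((StdForm.antidiagonal 3).over K) M} |
      latticeGraphIso σ ϖ ((StdForm.antidiagonal 3).over K) γ v = v ∧ IsVertexLattice σ ϖ ((StdForm.antidiagonal 3).over K) 0 v.1}.Finite :=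
    hfin.subset fun v hv => hv.1
  have hfinB : {v : {M : Submodule 𝒪[K] (Fin 3 → K) // IsVertex σ ϖ ((StdForm.antidiagonal 3).over K) M} |
      latticeGraphIso σ ϖ ((StdForm.antidiagonal 3).over K) γ v = v ∧ IsVertexLattice σ ϖ ((StdForm.antidiagonal 3).over K) 2 v.1}.Finite :=
    hfin.subset fun v hv => hv.1
  rw [hunion, Set.ncard_union_eq (Set.disjoint_left.2 fun v hv hv' => hnot _ hv'.2 hv.2) hfinA hfinB,
    ncard_fixed_isVertexLattice_eq_fixedVertexCount γ 0, ncard_fixed_isVertexLattice_eq_fixedVertexCount γ 2,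
    ncard_fixedEdges_eq_fixedEdgeCount hvσ hϖ γ] at hE
  omega

end Identity

/-! ## §3  The frame element `Γ_b`: a unimodular diagonal model, (F) finitely many fixed vertices, (N) a fixed self-dual vertex -/

section Frame

variable {K : Type} [Field K] [Valued K ℤᵐ⁰] {σ : K →+* K} {ϖ : K}

/-- **THE RESCALED (UNIMODULAR) DIAGONAL MODEL OF A FOUR-FRAME.**  For a four-frame family `f` (★ #0a H7) at a frame `b`, if every non-zero `σ`-fixed element has EVEN valuation
(datum clause (4)), there are `A ∈ GL₃(K)` and `d` with `ᵗσ(A)·Φ₃·A = diag(d)`, `|d_i| = 1`, and `frameElt σ f b α β = A·diag(α, β, 1)·A⁻¹` for all `α, β`: `A = Q_b·diag(ϖ^{n_i})`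
where `Q_b` is the frame matrix (★ `formCongr_frameMatrix`, ★ `frameElt_eq_conj_diagonal`) and `|⟨f_i, f_i⟩| = exp(2n_i)` (the norms are `σ`-fixed, ★ `σ_pairing_eq`).
[cite: BruhatTits1972, §10] [cite: Rogawski1990, §3.6 pp. 28–29] -/
theorem exists_unimodular_diagonal_model_frameElt (hσ : ∀ x, σ (σ x) = x) (hvσ : ∀ a, Valued.v (σ a) = Valued.v a) (hϖ : Valued.v ϖ = WithZero.exp (-1 : ℤ))
    (heven : ∀ x : K, σ x = x → x ≠ 0 → ∃ n : ℤ, Valued.v x = WithZero.exp (2 * n))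
    {f : Fin 4 → Fin 3 → (Fin 3 → K)} (hf : IsFourFrameFamily σ f) (b : Fin 4) :
    ∃ (A : GL (Fin 3) K) (d : Fin 3 → K), (∀ i, Valued.v (d i) = 1) ∧ formCongr σ A ((StdForm.antidiagonal 3).over K) = Matrix.diagonal d ∧
      ∀ α β : K, frameElt σ f b α β = (A : Matrix (Fin 3) (Fin 3) K) * Matrix.diagonal ![α, β, 1] * ((A⁻¹ : GL (Fin 3) K) : Matrix (Fin 3) (Fin 3) K) := by
  classical
  have hϖ0 : ϖ ≠ 0 := CartanUnique.uniformizer_ne_zero hϖ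
  have hHh : (((StdForm.antidiagonal 3).over K).map σ)ᵀ = (StdForm.antidiagonal 3).over K := by rw [StdForm.over_map, StdForm.transpose_over]
  obtain ⟨-, hN0, -, -, -⟩ := hf b
  -- the norms `N_i = ⟨f_i, f_i⟩` are `σ`-fixed and non-zero, hence of even valuation `2 n_i`
  have hn : ∀ i : Fin 3, ∃ n : ℤ, Valued.v (pairing σ ((StdForm.antidiagonal 3).over K) (f b i) (f b i)) = WithZero.exp (2 * n) := fun i =>
    heven _ (σ_pairing_eq hσ hHh (f b i) (f b i)) (hN0 i)
  choose n hn using hn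
  -- the frame matrix `Q` and the rescaling `C = diag(ϖ^{n_i})`
  set Q : GL (Fin 3) K := ((Matrix.isUnit_iff_isUnit_det _).2 (isUnit_det_frameMatrix hf b)).unit with hQ_def
  have hQ : (Q : Matrix (Fin 3) (Fin 3) K) = (Matrix.of (f b))ᵀ := rfl
  have hc0 : ∀ i : Fin 3, (ϖ ^ (n i) : K) ≠ 0 := fun i => zpow_ne_zero _ hϖ0
  let C : GL (Fin 3) K :=
    ⟨Matrix.diagonal fun i => (ϖ ^ (n i) : K), Matrix.diagonal fun i => (ϖ ^ (n i) : K)⁻¹,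
      by rw [Matrix.diagonal_mul_diagonal, ← Matrix.diagonal_one]; congr 1; funext i; exact mul_inv_cancel₀ (hc0 i),
      by rw [Matrix.diagonal_mul_diagonal, ← Matrix.diagonal_one]; congr 1; funext i; exact inv_mul_cancel₀ (hc0 i)⟩
  have hC : (C : Matrix (Fin 3) (Fin 3) K) = Matrix.diagonal fun i => (ϖ ^ (n i) : K) := rfl
  have hCinv : ((C⁻¹ : GL (Fin 3) K) : Matrix (Fin 3) (Fin 3) K) = Matrix.diagonal fun i => (ϖ ^ (n i) : K)⁻¹ := rfl
  refine ⟨Q * C, fun i => σ (ϖ ^ (n i)) * pairing σ ((StdForm.antidiagonal 3).over K) (f b i) (f b i) * ϖ ^ (n i), fun i => ?_, ?_, fun α β => ?_⟩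
  · -- `|σ(ϖ^{n}) N ϖ^{n}| = exp(-n) exp(2n) exp(-n) = 1`
    rw [map_mul, map_mul, hvσ, CartanUnique.v_uniformizer_zpow hϖ, hn i, ← WithZero.exp_add, ← WithZero.exp_add, ← WithZero.exp_zero]
    congr 1; ring
  · rw [formCongr_mul_eq, formCongr_frameMatrix hf b Q hQ, formCongr, hC, Matrix.diagonal_map (map_zero σ), Matrix.diagonal_transpose,
      Matrix.diagonal_mul_diagonal, Matrix.diagonal_mul_diagonal]
  · rw [frameElt_eq_conj_diagonal hf b α β Q hQ, _root_.mul_inv_rev, Units.val_mul, Units.val_mul, hC, hCinv]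
    simp only [Matrix.mul_assoc]
    congr 1
    rw [← Matrix.mul_assoc (Matrix.diagonal ![α, β, 1]), Matrix.diagonal_mul_diagonal, ← Matrix.mul_assoc, Matrix.diagonal_mul_diagonal]
    congr 2
    funext i
    rw [mul_left_comm, mul_inv_cancel₀ (hc0 i), mul_one]

/-- **(F) THE FIXED VERTEX SET OF THE FRAME ELEMENT `Γ_b` IS FINITE** (finite residue field): for `γ ∈ U(σ, Φ₃)` with matrix `frameElt σ f b α β`, `α, β ∈ E¹` and the datum
REGULAR (`α ≠ β`, `α ≠ 1`, `β ≠ 1`), the `γ`-fixed vertices of the lattice graph of `(K³, Φ₃)` form a finite set — ★ J4a `finite_setOf_latticeGraphIso_diagonal_eq` for the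
regular diagonal `diag(α, β, 1)` in the unimodular diagonal model of `exists_unimodular_diagonal_model_frameElt`, transported back by ★ `finite_setOf_latticeGraphIso_eq_of_model`.
[cite: Kottwitz1986BaseChangeUnits, §1 pp. 240–241] [cite: BruhatTits1972, §10] [cite: Serre1980Trees, II §1.1] -/
theorem finite_fixedVertices_frameElt [Finite 𝓀[K]] (hσ : ∀ x, σ (σ x) = x) (hvσ : ∀ a, Valued.v (σ a) = Valued.v a) (hϖ : Valued.v ϖ = WithZero.exp (-1 : ℤ))
    (heven : ∀ x : K, σ x = x → x ≠ 0 → ∃ n : ℤ, Valued.v x = WithZero.exp (2 * n))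
    {f : Fin 4 → Fin 3 → (Fin 3 → K)} (hf : IsFourFrameFamily σ f) (b : Fin 4) {α β : K}
    (hα : α * σ α = 1) (hβ : β * σ β = 1) (hαβ : α ≠ β) (hα1 : α ≠ 1) (hβ1 : β ≠ 1)
    (γ : ↥(unitaryGroupOfForm σ ((StdForm.antidiagonal 3).over K))) (hγ : ((γ : GL (Fin 3) K) : Matrix (Fin 3) (Fin 3) K) = frameElt σ f b α β) :
    {v | latticeGraphIso σ ϖ ((StdForm.antidiagonal 3).over K) γ v = v}.Finite := by
  classical
  obtain ⟨A, d, hd, hA, hconj⟩ := exists_unimodular_diagonal_model_frameElt hσ hvσ hϖ heven hf b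
  have hsσ : ∀ i, (![α, β, 1] : Fin 3 → K) i * σ ((![α, β, 1] : Fin 3 → K) i) = 1 := fun i => by
    fin_cases i
    · exact hα
    · exact hβ
    · simp
  obtain ⟨T, hT⟩ := exists_unitary_diagonal_coe_eq_diagonal (σ := σ) d ![α, β, 1] hsσ
  have hγT : (γ : GL (Fin 3) K) = A * (T : GL (Fin 3) K) * A⁻¹ :=
    Units.ext (by rw [hγ, hconj α β, Units.val_mul, Units.val_mul, hT])
  have hαv : Valued.v α = 1 := UnitaryLatticeTree.v_eq_one_of_mul_map_eq_one hvσ hα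
  have hβv : Valued.v β = 1 := UnitaryLatticeTree.v_eq_one_of_mul_map_eq_one hvσ hβ
  have hs : ∀ l, Valued.v ((![α, β, 1] : Fin 3 → K) l) ≤ 1 := fun l => by
    fin_cases l
    · exact hαv.le
    · exact hβv.le
    · simp
  have hδ0 : ((![α, β, 1] : Fin 3 → K) 0 - (![α, β, 1] : Fin 3 → K) 1) * ((![α, β, 1] : Fin 3 → K) 0 - (![α, β, 1] : Fin 3 → K) 2) *
      ((![α, β, 1] : Fin 3 → K) 1 - (![α, β, 1] : Fin 3 → K) 2) ≠ 0 :=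
    mul_ne_zero (mul_ne_zero (sub_ne_zero.2 hαβ) (sub_ne_zero.2 hα1)) (sub_ne_zero.2 hβ1)
  exact finite_setOf_latticeGraphIso_eq_of_model σ ϖ (c := (1 : K)) (map_one _) ((StdForm.antidiagonal 3).over K) A (H' := Matrix.diagonal d)
    (by rw [one_smul, hA]) γ T hγT (finite_setOf_latticeGraphIso_diagonal_eq hvσ hϖ hd hs hδ0 (v_vandermonde_le_of_forall_v_le_one hs) T hT)

/-- **(N) THE FRAME ELEMENT `Γ_b` FIXES A (SELF-DUAL) VERTEX**: with `A` the unimodular frame of `exists_unimodular_diagonal_model_frameElt`, `M₀ = A·𝒪³` is a self-dual vertex of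
`(K³, Φ₃)` (★ `isSelfDualLattice_stdLattice_diagonal` in the model, ★ `isVertex_formCongr_mapGL_inv_iff`) and `Γ_b·M₀ = A·diag(α, β, 1)·𝒪³ = M₀` (`α, β ∈ E¹` are units; ★
`mapGL_stdLattice_eq_iff`). [cite: Serre1980Trees, I §6.1; II §1.1] [cite: BruhatTits1972, §10] -/
theorem exists_fixedVertex_frameElt (hσ : ∀ x, σ (σ x) = x) (hvσ : ∀ a, Valued.v (σ a) = Valued.v a) (hϖ : Valued.v ϖ = WithZero.exp (-1 : ℤ))
    (heven : ∀ x : K, σ x = x → x ≠ 0 → ∃ n : ℤ, Valued.v x = WithZero.exp (2 * n))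
    {f : Fin 4 → Fin 3 → (Fin 3 → K)} (hf : IsFourFrameFamily σ f) (b : Fin 4) {α β : K} (hα : α * σ α = 1) (hβ : β * σ β = 1)
    (γ : ↥(unitaryGroupOfForm σ ((StdForm.antidiagonal 3).over K))) (hγ : ((γ : GL (Fin 3) K) : Matrix (Fin 3) (Fin 3) K) = frameElt σ f b α β) :
    ∃ v, latticeGraphIso σ ϖ ((StdForm.antidiagonal 3).over K) γ v = v := by
  classical
  obtain ⟨A, d, hd, hA, hconj⟩ := exists_unimodular_diagonal_model_frameElt hσ hvσ hϖ heven hf b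
  have hsσ : ∀ i, (![α, β, 1] : Fin 3 → K) i * σ ((![α, β, 1] : Fin 3 → K) i) = 1 := fun i => by
    fin_cases i
    · exact hα
    · exact hβ
    · simp
  obtain ⟨T, hT⟩ := exists_unitary_diagonal_coe_eq_diagonal (σ := σ) d ![α, β, 1] hsσ
  have hγT : (γ : GL (Fin 3) K) = A * (T : GL (Fin 3) K) * A⁻¹ :=
    Units.ext (by rw [hγ, hconj α β, Units.val_mul, Units.val_mul, hT])
  have hs : ∀ l, Valued.v ((![α, β, 1] : Fin 3 → K) l) ≤ 1 := fun l => by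
    fin_cases l
    · exact (UnitaryLatticeTree.v_eq_one_of_mul_map_eq_one hvσ hα).le
    · exact (UnitaryLatticeTree.v_eq_one_of_mul_map_eq_one hvσ hβ).le
    · simp
  -- `T = diag(α, β, 1)` fixes the root `𝒪³`
  have hTinv : (((T : GL (Fin 3) K)⁻¹ : GL (Fin 3) K) : Matrix (Fin 3) (Fin 3) K) = Matrix.diagonal fun i => σ ((![α, β, 1] : Fin 3 → K) i) :=
    Units.inv_eq_of_mul_eq_one_right (by rw [hT, Matrix.diagonal_mul_diagonal, ← Matrix.diagonal_one]; congr 1; funext i; exact hsσ i)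
  have hTL₀ : mapGL (T : GL (Fin 3) K) (stdLattice K 3) = stdLattice K 3 := by
    refine (mapGL_stdLattice_eq_iff (T : GL (Fin 3) K)).2 ⟨fun i j => ?_, fun i j => ?_⟩
    · rw [hT]
      by_cases hij : i = j
      · subst hij; rw [Matrix.diagonal_apply_eq]; exact hs i
      · rw [Matrix.diagonal_apply_ne _ hij, map_zero]; exact zero_le
    · rw [hTinv]
      by_cases hij : i = j
      · subst hij; rw [Matrix.diagonal_apply_eq, hvσ]; exact hs i
      · rw [Matrix.diagonal_apply_ne _ hij, map_zero]; exact zero_le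
  -- `M₀ = A·𝒪³` is a self-dual vertex
  have hϖ1 : Valued.v ϖ ≤ 1 := CartanUnique.uniformizer_mem_integer hϖ
  have hv : IsVertex σ ϖ ((StdForm.antidiagonal 3).over K) (mapGL A (stdLattice K 3)) := by
    apply (isVertex_formCongr_mapGL_inv_iff σ ϖ ((StdForm.antidiagonal 3).over K) A (mapGL A (stdLattice K 3))).1
    rw [← mapGL_mul, inv_mul_cancel, mapGL_one, hA]
    exact ⟨0, isSelfDualLattice_stdLattice_diagonal σ hϖ1 hd⟩
  refine ⟨⟨mapGL A (stdLattice K 3), hv⟩, Subtype.ext ?_⟩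
  change mapGL (γ : GL (Fin 3) K) (mapGL A (stdLattice K 3)) = mapGL A (stdLattice K 3)
  rw [← mapGL_mul, hγT, inv_mul_cancel_right, mapGL_mul, hTL₀]

end Frame

/-! ## §4  The head: `stub_U3_edgeLaw_t2` BY NAME -/

/-- **THE (K-1)(c) EDGE IDENTITY `e(Γ_b) + 1 = n₀(Γ_b) + n₂(Γ_b)` — the statement of the tier-1 stub `F0P3cDyRamFourFrameU3.stub_U3_edgeLaw_t2` TOKEN FOR TOKEN.**  Behind the
dyadic fence and the ramified quadratic datum, for every four-frame family `f`, element datum `(α, β; n₁, n₂, n₃)` at threshold `depthOfRecord d` and frames `Γ b` with matrix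
`frameElt σ f b α β`: `fixedEdgeCount σ ϖ (Γ b) + 1 = fixedVertexCount σ ϖ 0 (Γ b) + fixedVertexCount σ ϖ 2 (Γ b)`.  PROOF: `Γ b ∈ U(σ, Φ₃)` (★ `exists_unitary_coe_eq_smul_frameElt`
at `z = 1`); the fenced wild lattice graph is a tree (★ `wildTree_of_wildTransitivity wildTransitivity_holds`); §3 (F)∕(N); §2. [cite: Serre1980Trees, I §2.2; I §6.1]
[cite: Kottwitz1988, §2 Theorem 2] [cite: Kottwitz1986BaseChangeUnits, §1 pp. 240–241] -/
theorem edgeLaw_t2 :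
    ∀ {K : Type} [Field K] [Valued K ℤᵐ⁰] [CompleteSpace K] [Fintype 𝓀[K]] (σ : K →+* K) (ϖ : K) (d t : ℕ),
      DyadicFence (K := K)
        (IsRamifiedQuadraticDatum σ ϖ d t →
          ∀ (f : Fin 4 → Fin 3 → (Fin 3 → K)), IsFourFrameFamily σ f →
          ∀ (α β : K) (n₁ n₂ n₃ : ℕ), IsElementDatum σ ϖ (depthOfRecord d) α β n₁ n₂ n₃ →
          ∀ (Γ : Fin 4 → GL (Fin 3) K), (∀ b, (Γ b : Matrix (Fin 3) (Fin 3) K) = frameElt σ f b α β) →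
          ∀ b : Fin 4, fixedEdgeCount σ ϖ (Γ b) + 1 = fixedVertexCount σ ϖ 0 (Γ b) + fixedVertexCount σ ϖ 2 (Γ b)) := by
  intro K _ _ _ _ σ ϖ d t h2 hD f hf α β n₁ n₂ n₃ hE Γ hΓ b
  obtain ⟨hα, hβ, hαβ, hα1, hβ1, -⟩ := hE
  -- `Γ b ∈ U(σ, Φ₃)`
  obtain ⟨U, hU, hUe⟩ := exists_unitary_coe_eq_smul_frameElt hf b (z := (1 : K)) (by rw [mul_comm]; exact hα) (by rw [mul_comm]; exact hβ) (by rw [map_one, mul_one])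
  have hUΓ : U = Γ b := Units.ext (by rw [hUe, one_smul, hΓ b])
  have hmem : Γ b ∈ unitaryGroupOfForm σ ((StdForm.antidiagonal 3).over K) := hUΓ ▸ hU
  -- the fenced wild tree, (F), (N), and §2
  have htree : (latticeGraph σ ϖ ((StdForm.antidiagonal 3).over K)).IsTree := wildTree_of_wildTransitivity wildTransitivity_holds σ ϖ d t hD h2
  exact fixedEdgeCount_add_one_eq_of_finite_of_fixed hD.2.1 hD.2.2.1 htree ⟨Γ b, hmem⟩
    (finite_fixedVertices_frameElt hD.1 hD.2.1 hD.2.2.1 hD.2.2.2.1 hf b hα hβ hαβ hα1 hβ1 ⟨Γ b, hmem⟩ (hΓ b))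
    (exists_fixedVertex_frameElt hD.1 hD.2.1 hD.2.2.1 hD.2.2.2.1 hf b hα hβ ⟨Γ b, hmem⟩ (hΓ b))

end Summit.HodgeConjecture.HodgeConjecture.Cruxes.H413.F0P3cDyRamU3EdgeLawT2

end
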